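import Summits.QuantumFields.YangMills.Theorems.TwistedTraceScaling.Negative.WindowFloorGuards
import Summits.QuantumFields.YangMills.Theorems.LuscherReductionTwistedTraceScalingBaseOne
import HarnessLib

/-!
# What the window floor W(L) REALLY asks of a Born–Oppenheimer comparison — crux disprover, cycle 61
# (route `LuscherReduction`, crux `TwistedTraceScaling` stmt-QuantumFields-20203, skeleton «twolattice» rev 3, stub S-BASE; `--supports`, helper only)

After ✓`Base.stmt_of_window` (lead g23) the registered stub `stub_fixedLatticeTraceLaw` is closed modulo, for every `L ≥ 2`, the window floor

  `W(L) : ∀ c₁ > 0, ∃ g : ℕ → ℝ, g ≥ 0, (∀ t > 0, Summable (e^{−t·g k})) ∧ ∃ β₀, ∀ β ≥ β₀, ∀ k, λ_k(β,L) ≤ exp(−u(β)·min (g k) (c₁ log β))·λ₀(β,L)`,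
  `u(β) = Λ(β,L)/L`.

This file is the standing disprover's mutation pass on that text (companion of R72 `…Negative.WindowFloorGuards`, which recorded what W FORCES):
it records, kernel-checked and `def`-free, what W does NOT need, and locates the one open brick of the suggested design
(`HANDOFF-g23.md` «WHAT IS LEFT OF S-BASE = W(L) ONLY»: one-site W at `B = L³β` + a `k`-uniform BO upper split).

* §1 abstract: a Laplace-summable profile stays Laplace-summable under `g ↦ max ((g − ε)/ρ) 0` (`summable_exp_neg_mul_shift`), and the pointwise
  conversion `le_windowShape_of_slack`: a bound `x ≤ e^{εv}·e^{−v·min(g, cap)}·x₀` in a reference unit `v` with ADDITIVE slack `ε·v`, together with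
  the trivial `x ≤ x₀`, gives the W-shape `x ≤ e^{−u·min(g', cap')}·x₀` in any unit `u ≤ ρ·v` with `g' = max((g−ε)/ρ) 0`, once `u·cap' ≤ v·(cap − ε)`.
* §2 ★ `windowFloor_text_of_slack` — W(L) is INSENSITIVE to a `k`-uniform additive slack `e^{ε·u(β)}` (any fixed `ε`, not `ε → 0`): the levels with
  `g k ≤ ε` are finitely many and need only `λ_k ≤ λ₀` (antitone levels).  So the sharpness `∀ ε > 0` of the per-level laws COARSE-UPPER ∕ BO_up is NOT
  load-bearing for W; what is load-bearing is `k`-UNIFORMITY below the cap.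
  ★ `windowFloor_text_of_reference_transfer` — W(L) from (i) a window floor for REFERENCE levels `μ β k` in a reference unit `v β` (shape of
  ✓`OST.windowFloor_all`), (ii) unit comparability `u ≤ ρ·v` eventually, (iii) `μ β 0 > 0` eventually, and (iv) the CAPPED TRANSFER
  `∀ c > 0, ∃ ε β₀, ∀ β ≥ β₀, ∀ k, (∀ j < k, μ β j > e^{−v·c·log β}·μ β 0) → λ_k·μ β 0 ≤ e^{ε·v}·λ₀·max (μ β k) (e^{−v·c·log β}·μ β 0)`
  (comparison demanded ONLY while the constraint levels `j < k` are reference-low-lying; `max` so that a reference gap at the cap costs nothing).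
* §3 ★★ `windowFloor_text_of_uboCap` — the instantiation at the one-site model, `μ β k = μ_k(L³β)`, `v β = λ_b(L³β)`: (i) is ✓`OST.windowFloor_all`,
  (ii) is ✓`BOHandover.exists_luscherLambda_le_mul_bareLambda`, (iii) is ✓`levelValue_zero_su2Rep_pos`; so
  **W(L) ⟸ UBO-CAP(L)**, the `k`-UNIFORM CAPPED BO UPPER COMPARISON WITH FIXED SLACK, in lane A's currency (`boLower_record` is its per-level converse):
  `UBO-CAP(L) : ∀ c > 0, ∃ ε β₀, ∀ β ≥ β₀, ∀ k, (∀ j < k, μ_j(L³β) > β^{−cλ_b}·μ₀(L³β)) → λ_k(β,L)·μ₀(L³β) ≤ e^{ελ_b(L³β)}·λ₀(β,L)·max (μ_k(L³β)) (β^{−cλ_b}μ₀(L³β))`.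
  This is the located cut: ONE `ε` (even `ε = 1`), ONE `β₀` for all `k`, constraints = the reference-low one-site levels only (femto energy `< c log β`,
  one-site radius `≲ (c log β)·B^{−1/3} ≪ B^{−s}`, inside every core of record), valley ∕ shell ∕ stiff pieces only need gain `≥ (c log β + ε)λ_b`
  (R72 §3: with RATE, not the `∀A ∃β0` texts).
HONEST FRAMING: structural lemmas about an OPEN hypothesis text (W(L)) of a stub (S-BASE) of a child of the CONDITIONAL reduction route R2b1 (femto
rung); UBO-CAP(L) is OPEN; nothing here proves or refutes W(L) or the crux; not infinite volume, not a mass gap, not Clay.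
-/

set_option autoImplicit false

noncomputable section

open MeasureTheory Filter Topology Real
open scoped BigOperators
open Literature.MathematicalPhysics.QuantumFieldTheory hiding SU2
open Literature.MathematicalPhysics.QuantumLattice
open Summit.QuantumFields.YangMills.Theorems.FemtoTransferGap

namespace Summit.QuantumFields.YangMills.Theorems.TwistedTraceScaling.Negative.R74

/-! ## §1 Abstract: slack and unit conversion in the window shape -/

/-- A Laplace-summable profile stays Laplace-summable under the shift–rescale `g ↦ max ((g − ε)/ρ) 0` (`ρ > 0`). [folklore] -/
theorem summable_exp_neg_mul_shift {g : ℕ → ℝ} {ε ρ : ℝ} (hρ : 0 < ρ)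
    (hsum : ∀ t : ℝ, 0 < t → Summable fun k : ℕ => Real.exp (-t * g k)) (t : ℝ) (ht : 0 < t) :
    Summable fun k : ℕ => Real.exp (-t * max ((g k - ε) / ρ) 0) := by
  have hs := (hsum (t / ρ) (div_pos ht hρ)).mul_left (Real.exp (t * ε / ρ))
  refine Summable.of_nonneg_of_le (fun k => (Real.exp_pos _).le) (fun k => ?_) hs
  rw [← Real.exp_add, Real.exp_le_exp]
  have h1 : (g k - ε) / ρ ≤ max ((g k - ε) / ρ) 0 := le_max_left _ _
  have h2 : -t * max ((g k - ε) / ρ) 0 ≤ -t * ((g k - ε) / ρ) := by nlinarith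
  calc -t * max ((g k - ε) / ρ) 0 ≤ -t * ((g k - ε) / ρ) := h2
    _ = t * ε / ρ + -(t / ρ) * g k := by ring

/-- Pointwise conversion: a bound `x ≤ e^{εv}·(e^{−v·min(g,cap)}·x₀)` in a reference unit `v`, additive slack `εv`, together with `x ≤ x₀`, gives the
window shape `x ≤ e^{−u·min(g',cap')}·x₀` in a unit `u ≤ ρv` with `g' = max((g−ε)/ρ) 0`, provided `u·cap' ≤ v·(cap − ε)`. [folklore] -/
theorem le_windowShape_of_slack {u v ρ ε g cap cap' x x0 : ℝ} (hx0 : 0 ≤ x0) (hu : 0 ≤ u) (hρ : 0 < ρ)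
    (huv : u ≤ ρ * v) (hcap : u * cap' ≤ v * (cap - ε)) (hxx0 : x ≤ x0)
    (h : x ≤ Real.exp (ε * v) * (Real.exp (-(v * min g cap)) * x0)) :
    x ≤ Real.exp (-(u * min (max ((g - ε) / ρ) 0) cap')) * x0 := by
  set T : ℝ := u * min (max ((g - ε) / ρ) 0) cap' with hT
  set M : ℝ := max 0 (v * (min g cap - ε)) with hM
  -- (1) `x ≤ e^{−M} x₀`
  have h1 : x ≤ Real.exp (-M) * x0 := by
    rcases le_total (v * (min g cap - ε)) 0 with hle | hge
    · have hM0 : M = 0 := by rw [hM]; exact max_eq_left hle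
      rw [hM0, neg_zero, Real.exp_zero, one_mul]; exact hxx0
    · have hM1 : M = v * (min g cap - ε) := by rw [hM]; exact max_eq_right hge
      have heq : Real.exp (ε * v) * (Real.exp (-(v * min g cap)) * x0) = Real.exp (-(v * (min g cap - ε))) * x0 := by
        rw [← mul_assoc, ← Real.exp_add]; congr 1; ring_nf
      rw [hM1, ← heq]; exact h
  -- (2) `T ≤ M`
  have h2 : T ≤ M := by
    by_cases hg : g ≤ ε
    · have hmax : max ((g - ε) / ρ) 0 = 0 :=
        max_eq_right (div_nonpos_of_nonpos_of_nonneg (by linarith) hρ.le)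
      have hT0 : T ≤ 0 := by
        rw [hT, hmax]
        have : min (0 : ℝ) cap' ≤ 0 := min_le_left _ _
        nlinarith
      exact hT0.trans (le_max_left _ _)
    · push Not at hg
      have hgpos : 0 < (g - ε) / ρ := div_pos (by linarith) hρ
      have hmax : max ((g - ε) / ρ) 0 = (g - ε) / ρ := max_eq_left hgpos.le
      rw [hT, hmax]
      rcases le_total g cap with hgc | hcg
      · have hmin : min g cap = g := min_eq_left hgc
        have hMge : v * (g - ε) ≤ M := by rw [hM, hmin]; exact le_max_right _ _
        have hρv : u * ((g - ε) / ρ) ≤ (ρ * v) * ((g - ε) / ρ) := mul_le_mul_of_nonneg_right huv hgpos.le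
        have hρv' : (ρ * v) * ((g - ε) / ρ) = v * (g - ε) := by
          field_simp
        calc u * min ((g - ε) / ρ) cap' ≤ u * ((g - ε) / ρ) := mul_le_mul_of_nonneg_left (min_le_left _ _) hu
          _ ≤ (ρ * v) * ((g - ε) / ρ) := hρv
          _ = v * (g - ε) := hρv'
          _ ≤ M := hMge
      · have hmin : min g cap = cap := min_eq_right hcg
        have hMge : v * (cap - ε) ≤ M := by rw [hM, hmin]; exact le_max_right _ _
        calc u * min ((g - ε) / ρ) cap' ≤ u * cap' := mul_le_mul_of_nonneg_left (min_le_right _ _) hu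
          _ ≤ v * (cap - ε) := hcap
          _ ≤ M := hMge
  calc x ≤ Real.exp (-M) * x0 := h1
    _ ≤ Real.exp (-T) * x0 := mul_le_mul_of_nonneg_right (Real.exp_le_exp.mpr (by linarith)) hx0

/-! ## §2 W(L) tolerates fixed slack; W(L) from a capped reference transfer -/

section Levels

variable (L : ℕ) [NeZero L]

/-- ★ **W(L) is insensitive to a `k`-uniform additive slack `e^{ε·u(β)}`** (`u = Λ(β,L)/L`; any fixed `ε`, chosen per cap): the text with slack
implies the text.  (New profile `max (g − ε) 0`; the finitely many levels with `g k ≤ ε` need only `λ_k ≤ λ₀`; cap `2c₁` feeds cap `c₁` once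
`log β ≥ ε/c₁`.)  So the `∀ ε > 0` sharpness of the per-level laws is not what W needs. [cite: ReedSimonIV1978, Thm. XIII.1] -/
theorem windowFloor_text_of_slack
    (h : ∀ c₁ : ℝ, 0 < c₁ → ∃ ε : ℝ, ∃ g : ℕ → ℝ, (∀ k, 0 ≤ g k) ∧
      (∀ t : ℝ, 0 < t → Summable fun k : ℕ => Real.exp (-t * g k)) ∧
      ∃ β0 : ℝ, ∀ β : ℝ, β0 ≤ β → ∀ k : ℕ,
        levelValue su2Rep L β k ≤ Real.exp (ε * (luscherLambda β L / L)) *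
          (Real.exp (-(luscherLambda β L / L * min (g k) (c₁ * Real.log β))) * levelValue su2Rep L β 0)) :
    ∀ c₁ : ℝ, 0 < c₁ → ∃ g : ℕ → ℝ, (∀ k, 0 ≤ g k) ∧
      (∀ t : ℝ, 0 < t → Summable fun k : ℕ => Real.exp (-t * g k)) ∧
      ∃ β0 : ℝ, ∀ β : ℝ, β0 ≤ β → ∀ k : ℕ,
        levelValue su2Rep L β k ≤
          Real.exp (-(luscherLambda β L / L * min (g k) (c₁ * Real.log β))) * levelValue su2Rep L β 0 := by
  intro c₁ hc₁
  obtain ⟨ε, g, hg0, hgsum, β0, hW⟩ := h (2 * c₁) (by positivity)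
  obtain ⟨β1, h1⟩ := TwoLattice.Base.eventually_unit_le L one_pos
  have hsum' : ∀ t : ℝ, 0 < t → Summable fun k : ℕ => Real.exp (-t * max (g k - ε) 0) := by
    intro t ht
    have := summable_exp_neg_mul_shift (ε := ε) one_pos hgsum t ht
    simpa only [div_one] using this
  refine ⟨fun k => max (g k - ε) 0, fun k => le_max_right _ _, hsum', max (max β0 β1) (Real.exp (ε / c₁)), fun β hβ k => ?_⟩
  have hβ0 : β0 ≤ β := le_trans ((le_max_left _ _).trans (le_max_left _ _)) hβ
  have hβ1 : β1 ≤ β := le_trans ((le_max_right _ _).trans (le_max_left _ _)) hβ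
  have hβe : Real.exp (ε / c₁) ≤ β := le_trans (le_max_right _ _) hβ
  obtain ⟨hβone, hu, -⟩ := h1 β hβ1
  have hβpos : 0 < β := by linarith
  have hlog : ε / c₁ ≤ Real.log β := (Real.le_log_iff_exp_le hβpos).2 hβe
  have hlog' : ε ≤ c₁ * Real.log β := by
    have := mul_le_mul_of_nonneg_left hlog hc₁.le
    rwa [mul_div_cancel₀ _ hc₁.ne'] at this
  have hl0 : 0 ≤ levelValue su2Rep L β 0 := (levelValue_su2Rep_pos hβpos 0).le
  have hanti : levelValue su2Rep L β k ≤ levelValue su2Rep L β 0 :=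
    KTRCalibration.levelValue_antitone hβpos.le (Nat.zero_le k)
  have hcap : luscherLambda β L / L * (c₁ * Real.log β) ≤ luscherLambda β L / L * (2 * c₁ * Real.log β - ε) := by
    apply mul_le_mul_of_nonneg_left _ hu.le
    linarith
  have key := le_windowShape_of_slack (ρ := 1) hl0 hu.le one_pos (by rw [one_mul]) hcap hanti (hW β hβ0 k)
  simpa only [div_one] using key

/-- ★ **W(L) from a window floor for REFERENCE levels and a CAPPED TRANSFER with fixed slack.**  Reference levels `μ β k` with unit `v β`
(think `μ β k = μ_k(L³β)`, `v β = λ_b(L³β)`): (i) a window floor for `μ` (shape of ✓`OST.windowFloor_all`, every cap `c`), (ii) `u(β) ≤ ρ·v(β)`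
eventually, (iii) `μ β 0 > 0` eventually, (iv) for every reference cap `c` a slack `ε` and ONE threshold `β₀` such that for all `β ≥ β₀` and ALL `k`
whose constraint levels `j < k` are reference-low (`μ β j > e^{−v·c·log β}μ β 0`):
`λ_k(β,L)·μ β 0 ≤ e^{ε·v β}·λ₀(β,L)·max (μ β k) (e^{−v·c·log β}μ β 0)`.  Then W(L) (verbatim `hW` of ✓`Base.fixedLatticeTraceLaw_of_upper_lower_window`,
`L1 ↦ L`).  Proof: cap `c = ρc₁ + 1`, profile `max((g − ε)/ρ) 0`; a level all of whose predecessors are reference-low is converted by §1; otherwise the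
least non-low predecessor `j₀ < k` has `λ_{j₀} ≤ e^{v(ε − c log β)}λ₀ ≤ β^{−u c₁}λ₀` and `λ_k ≤ λ_{j₀}`. [cite: ReedSimonIV1978, Thm. XIII.1]
[cite: Luscher1983, §3] -/
theorem windowFloor_text_of_reference_transfer {μ : ℝ → ℕ → ℝ} {v : ℝ → ℝ}
    (hμpos : ∃ β0 : ℝ, ∀ β : ℝ, β0 ≤ β → 0 < μ β 0)
    (hunit : ∃ ρ : ℝ, 0 < ρ ∧ ∃ β0 : ℝ, ∀ β : ℝ, β0 ≤ β → luscherLambda β L / L ≤ ρ * v β)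
    (hμW : ∀ c : ℝ, 0 < c → ∃ g : ℕ → ℝ, (∀ k, 0 ≤ g k) ∧
      (∀ t : ℝ, 0 < t → Summable fun k : ℕ => Real.exp (-t * g k)) ∧
      ∃ β0 : ℝ, ∀ β : ℝ, β0 ≤ β → ∀ k : ℕ,
        μ β k ≤ Real.exp (-(v β * min (g k) (c * Real.log β))) * μ β 0)
    (hUBO : ∀ c : ℝ, 0 < c → ∃ ε : ℝ, ∃ β0 : ℝ, ∀ β : ℝ, β0 ≤ β → ∀ k : ℕ,
      (∀ j : ℕ, j < k → Real.exp (-(v β * (c * Real.log β))) * μ β 0 < μ β j) →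
        levelValue su2Rep L β k * μ β 0 ≤
          Real.exp (ε * v β) * (levelValue su2Rep L β 0 * max (μ β k) (Real.exp (-(v β * (c * Real.log β))) * μ β 0))) :
    ∀ c₁ : ℝ, 0 < c₁ → ∃ g : ℕ → ℝ, (∀ k, 0 ≤ g k) ∧
      (∀ t : ℝ, 0 < t → Summable fun k : ℕ => Real.exp (-t * g k)) ∧
      ∃ β0 : ℝ, ∀ β : ℝ, β0 ≤ β → ∀ k : ℕ,
        levelValue su2Rep L β k ≤
          Real.exp (-(luscherLambda β L / L * min (g k) (c₁ * Real.log β))) * levelValue su2Rep L β 0 := by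
  classical
  intro c₁ hc₁
  obtain ⟨ρ, hρ, βu, hU⟩ := hunit
  set c : ℝ := ρ * c₁ + 1 with hc
  have hcpos : 0 < c := by positivity
  obtain ⟨ε, βa, hA⟩ := hUBO c hcpos
  obtain ⟨g, hg0, hgsum, βb, hB⟩ := hμW c hcpos
  obtain ⟨βm, hm⟩ := hμpos
  obtain ⟨β1, h1⟩ := TwoLattice.Base.eventually_unit_le L one_pos
  refine ⟨fun k => max ((g k - ε) / ρ) 0, fun k => le_max_right _ _, summable_exp_neg_mul_shift hρ hgsum,
    max (max (max βu βa) (max βb βm)) (max β1 (Real.exp ε)), fun β hβ k => ?_⟩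
  have hβu : βu ≤ β := le_trans (((le_max_left _ _).trans (le_max_left _ _)).trans (le_max_left _ _)) hβ
  have hβa : βa ≤ β := le_trans (((le_max_right _ _).trans (le_max_left _ _)).trans (le_max_left _ _)) hβ
  have hβb : βb ≤ β := le_trans (((le_max_left _ _).trans (le_max_right _ _)).trans (le_max_left _ _)) hβ
  have hβm : βm ≤ β := le_trans (((le_max_right _ _).trans (le_max_right _ _)).trans (le_max_left _ _)) hβ
  have hβ1 : β1 ≤ β := le_trans ((le_max_left _ _).trans (le_max_right _ _)) hβ
  have hβe : Real.exp ε ≤ β := le_trans ((le_max_right _ _).trans (le_max_right _ _)) hβ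
  obtain ⟨hβone, hu, -⟩ := h1 β hβ1
  have hβpos : 0 < β := by linarith
  have hlogε : ε ≤ Real.log β := (Real.le_log_iff_exp_le hβpos).2 hβe
  have hlog0 : 0 ≤ Real.log β := Real.log_nonneg hβone
  have huv : luscherLambda β L / L ≤ ρ * v β := hU β hβu
  have hv : 0 < v β := by
    by_contra hv
    push Not at hv
    have : ρ * v β ≤ 0 := mul_nonpos_of_nonneg_of_nonpos hρ.le hv
    linarith
  have hμ0 : 0 < μ β 0 := hm β hβm
  have hl0 : 0 ≤ levelValue su2Rep L β 0 := (levelValue_su2Rep_pos hβpos 0).le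
  set u : ℝ := luscherLambda β L / L with hudef
  set thr : ℝ := Real.exp (-(v β * (c * Real.log β))) * μ β 0 with hthr
  -- cap conversion `u·(c₁ log β) ≤ v·(c log β − ε)`
  have hcap : u * (c₁ * Real.log β) ≤ v β * (c * Real.log β - ε) := by
    have e1 : v β * (c * Real.log β - ε) = ρ * v β * (c₁ * Real.log β) + v β * (Real.log β - ε) := by rw [hc]; ring
    rw [e1]
    have e2 : u * (c₁ * Real.log β) ≤ ρ * v β * (c₁ * Real.log β) := mul_le_mul_of_nonneg_right huv (by positivity)
    have e3 : 0 ≤ v β * (Real.log β - ε) := mul_nonneg hv.le (by linarith)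
    linarith
  -- the target from the cap alone
  have htarget_of_cap : ∀ k : ℕ, levelValue su2Rep L β k ≤ Real.exp (-(u * (c₁ * Real.log β))) * levelValue su2Rep L β 0 →
      levelValue su2Rep L β k ≤ Real.exp (-(u * min (max ((g k - ε) / ρ) 0) (c₁ * Real.log β))) * levelValue su2Rep L β 0 := by
    intro k hk
    refine hk.trans (mul_le_mul_of_nonneg_right (Real.exp_le_exp.2 ?_) hl0)
    have : u * min (max ((g k - ε) / ρ) 0) (c₁ * Real.log β) ≤ u * (c₁ * Real.log β) :=
      mul_le_mul_of_nonneg_left (min_le_right _ _) hu.le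
    linarith
  -- a level whose predecessors are reference-low and whose own reference level is NOT low sits below the cap
  have hcapbound : ∀ k : ℕ, (∀ j : ℕ, j < k → thr < μ β j) → μ β k ≤ thr →
      levelValue su2Rep L β k ≤ Real.exp (-(u * (c₁ * Real.log β))) * levelValue su2Rep L β 0 := by
    intro k hlow hk
    have hAk := hA β hβa k hlow
    have hmax : max (μ β k) thr = thr := max_eq_right hk
    rw [hmax, hthr] at hAk
    -- `λ_k μ₀ ≤ e^{εv} λ₀ e^{−v c log β} μ₀`
    have h3 : levelValue su2Rep L β k * μ β 0 ≤
        (Real.exp (ε * v β) * Real.exp (-(v β * (c * Real.log β))) * levelValue su2Rep L β 0) * μ β 0 := by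
      calc levelValue su2Rep L β k * μ β 0
          ≤ Real.exp (ε * v β) * (levelValue su2Rep L β 0 * (Real.exp (-(v β * (c * Real.log β))) * μ β 0)) := hAk
        _ = (Real.exp (ε * v β) * Real.exp (-(v β * (c * Real.log β))) * levelValue su2Rep L β 0) * μ β 0 := by ring
    have h4 : levelValue su2Rep L β k ≤ Real.exp (ε * v β) * Real.exp (-(v β * (c * Real.log β))) * levelValue su2Rep L β 0 :=
      le_of_mul_le_mul_right h3 hμ0
    refine h4.trans (mul_le_mul_of_nonneg_right ?_ hl0)
    rw [← Real.exp_add, Real.exp_le_exp]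
    have : ε * v β + -(v β * (c * Real.log β)) = -(v β * (c * Real.log β - ε)) := by ring
    rw [this]
    linarith
  by_cases hall : ∀ j : ℕ, j < k → thr < μ β j
  · rcases le_total (μ β k) thr with hk | hk
    · exact htarget_of_cap k (hcapbound k hall hk)
    · -- reference-low level: transfer + reference floor + §1
      have hAk := hA β hβa k hall
      have hmax : max (μ β k) thr = μ β k := max_eq_left hk
      rw [hmax] at hAk
      have hBk := hB β hβb k
      have h3 : levelValue su2Rep L β k * μ β 0 ≤
          (Real.exp (ε * v β) * (Real.exp (-(v β * min (g k) (c * Real.log β))) * levelValue su2Rep L β 0)) * μ β 0 := by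
        calc levelValue su2Rep L β k * μ β 0 ≤ Real.exp (ε * v β) * (levelValue su2Rep L β 0 * μ β k) := hAk
          _ ≤ Real.exp (ε * v β) * (levelValue su2Rep L β 0 * (Real.exp (-(v β * min (g k) (c * Real.log β))) * μ β 0)) :=
              mul_le_mul_of_nonneg_left (mul_le_mul_of_nonneg_left hBk hl0) (Real.exp_pos _).le
          _ = (Real.exp (ε * v β) * (Real.exp (-(v β * min (g k) (c * Real.log β))) * levelValue su2Rep L β 0)) * μ β 0 := by ring
      have h4 : levelValue su2Rep L β k ≤
          Real.exp (ε * v β) * (Real.exp (-(v β * min (g k) (c * Real.log β))) * levelValue su2Rep L β 0) :=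
        le_of_mul_le_mul_right h3 hμ0
      have hanti : levelValue su2Rep L β k ≤ levelValue su2Rep L β 0 :=
        KTRCalibration.levelValue_antitone hβpos.le (Nat.zero_le k)
      exact le_windowShape_of_slack hl0 hu.le hρ huv hcap hanti h4
  · -- some predecessor is not reference-low: take the least one
    push Not at hall
    have hex : ∃ j : ℕ, j < k ∧ μ β j ≤ thr := by
      obtain ⟨j, hj, hle⟩ := hall
      exact ⟨j, hj, hle⟩
    set j₀ := Nat.find hex with hj₀
    have hspec := Nat.find_spec hex
    have hj₀k : j₀ < k := hspec.1
    have hj₀le : μ β j₀ ≤ thr := hspec.2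
    have hj₀low : ∀ i : ℕ, i < j₀ → thr < μ β i := by
      intro i hi
      have hmin := Nat.find_min hex hi
      by_contra hcon
      push Not at hcon
      exact hmin ⟨hi.trans hj₀k, hcon⟩
    have hb := hcapbound j₀ hj₀low hj₀le
    have hanti : levelValue su2Rep L β k ≤ levelValue su2Rep L β j₀ :=
      KTRCalibration.levelValue_antitone hβpos.le hj₀k.le
    exact htarget_of_cap k (hanti.trans hb)

/-! ## §3 ★★ The located cut: W(L) ⟸ UBO-CAP(L) (one-site reference at `B = L³β`) -/

/-- ★★ **W(L) from the `k`-uniform capped BO upper comparison with fixed slack.**  With the one-site model at `B = L³β` as reference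
(`μ_k(B) = levelValue su2Rep 1 B k`, unit `λ_b(B) = bareLambda B`): ✓`OST.windowFloor_all` is the reference floor (cap `c·log B ≥ c·log β`),
✓`BOHandover.exists_luscherLambda_le_mul_bareLambda` gives `Λ(β,L)/L ≤ 2λ_b(L³β)` eventually, ✓`levelValue_zero_su2Rep_pos` gives `μ₀ > 0`; hence the
window floor W(L) follows from
`UBO-CAP(L) : ∀ c > 0, ∃ ε β₀, ∀ β ≥ β₀, ∀ k, (∀ j < k, μ_j(L³β) > e^{−λ_b(L³β)·c·log β}μ₀(L³β)) →`
`             λ_k(β,L)·μ₀(L³β) ≤ e^{ε·λ_b(L³β)}·λ₀(β,L)·max (μ_k(L³β)) (e^{−λ_b(L³β)·c·log β}μ₀(L³β))`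
— ONE slack `ε` and ONE threshold for all levels; the comparison is asked only while the one-site constraint levels `j < k` are low-lying
(femto energy `< c·log β`).  Its per-level, `∀ ε`-sharp converse is lane A's ✓`boLower_record`. [cite: Luscher1983, §3] [cite: ReedSimonIV1978, Thm. XIII.1] -/
theorem windowFloor_text_of_uboCap
    (hUBO : ∀ c : ℝ, 0 < c → ∃ ε : ℝ, ∃ β0 : ℝ, ∀ β : ℝ, β0 ≤ β → ∀ k : ℕ,
      (∀ j : ℕ, j < k → Real.exp (-(bareLambda ((L : ℝ) ^ 3 * β) * (c * Real.log β))) * levelValue su2Rep 1 ((L : ℝ) ^ 3 * β) 0 <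
        levelValue su2Rep 1 ((L : ℝ) ^ 3 * β) j) →
        levelValue su2Rep L β k * levelValue su2Rep 1 ((L : ℝ) ^ 3 * β) 0 ≤
          Real.exp (ε * bareLambda ((L : ℝ) ^ 3 * β)) * (levelValue su2Rep L β 0 *
            max (levelValue su2Rep 1 ((L : ℝ) ^ 3 * β) k)
              (Real.exp (-(bareLambda ((L : ℝ) ^ 3 * β) * (c * Real.log β))) * levelValue su2Rep 1 ((L : ℝ) ^ 3 * β) 0))) :
    ∀ c₁ : ℝ, 0 < c₁ → ∃ g : ℕ → ℝ, (∀ k, 0 ≤ g k) ∧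
      (∀ t : ℝ, 0 < t → Summable fun k : ℕ => Real.exp (-t * g k)) ∧
      ∃ β0 : ℝ, ∀ β : ℝ, β0 ≤ β → ∀ k : ℕ,
        levelValue su2Rep L β k ≤
          Real.exp (-(luscherLambda β L / L * min (g k) (c₁ * Real.log β))) * levelValue su2Rep L β 0 := by
  have hL : (0 : ℝ) < L := by exact_mod_cast Nat.pos_of_ne_zero (NeZero.ne L)
  have hL1 : (1 : ℝ) ≤ L := by exact_mod_cast NeZero.one_le
  have hL3 : (1 : ℝ) ≤ (L : ℝ) ^ 3 := one_le_pow₀ hL1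
  refine windowFloor_text_of_reference_transfer L (μ := fun β k => levelValue su2Rep 1 ((L : ℝ) ^ 3 * β) k)
    (v := fun β => bareLambda ((L : ℝ) ^ 3 * β)) ⟨1, fun β _ => levelValue_zero_su2Rep_pos 1 _⟩ ?_ ?_ hUBO
  · -- unit comparability `Λ(β,L)/L ≤ 2·λ_b(L³β)` eventually
    obtain ⟨β₁, hlab⟩ := BOHandover.exists_luscherLambda_le_mul_bareLambda L (η := 1) one_pos
    obtain ⟨β₂, h₂⟩ := TwoLattice.Base.eventually_unit_le L one_pos
    refine ⟨2, two_pos, max β₁ β₂, fun β hβ => ?_⟩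
    have hβ₁ : β₁ ≤ β := le_trans (le_max_left _ _) hβ
    obtain ⟨-, hu, -⟩ := h₂ β (le_trans (le_max_right _ _) hβ)
    have hΛ : 0 < luscherLambda β L := by
      have := mul_pos hu hL
      rwa [div_mul_cancel₀ _ hL.ne'] at this
    have h := hlab β hβ₁ hΛ
    calc luscherLambda β L / L ≤ (1 + 1) * ((L : ℝ) * bareLambda ((L : ℝ) ^ 3 * β)) / L :=
          div_le_div_of_nonneg_right h hL.le
      _ = 2 * bareLambda ((L : ℝ) ^ 3 * β) := by field_simp; ring
  · -- reference floor: ✓`OST.windowFloor_all` at `B = L³β`, cap `c log B ≥ c log β`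
    intro c hc
    obtain ⟨g, hg0, hgsum, B0, hfloor⟩ := OST.windowFloor_all c hc
    refine ⟨g, hg0, hgsum, max B0 1, fun β hβ k => ?_⟩
    have hβ1 : 1 ≤ β := le_trans (le_max_right _ _) hβ
    have hβpos : 0 < β := by linarith
    have hB : B0 ≤ (L : ℝ) ^ 3 * β := by
      have h1 : B0 ≤ β := le_trans (le_max_left _ _) hβ
      have h2 : β ≤ (L : ℝ) ^ 3 * β := by nlinarith
      exact h1.trans h2
    have hBβ : β ≤ (L : ℝ) ^ 3 * β := by nlinarith
    refine (hfloor _ hB k).trans (mul_le_mul_of_nonneg_right (Real.exp_le_exp.2 ?_) (levelValue_zero_su2Rep_pos 1 _).le)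
    rw [neg_le_neg_iff]
    refine mul_le_mul_of_nonneg_left ?_ (bareLambda_pos' (by positivity)).le
    exact min_le_min le_rfl (mul_le_mul_of_nonneg_left (Real.log_le_log hβpos hBβ) hc.le)

end Levels

end Summit.QuantumFields.YangMills.Theorems.TwistedTraceScaling.Negative.R74

end
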